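import Summits.CriticalPhenomena.Ising3DConformalLimit.Theorems.GapForcesFarMerging.Negative.LineShapes
import Literature.Probability.LatticeModels.SourcedDoubleCurrentsSwitching
import Literature.Probability.LatticeModels.CurrentsPartialMonotonicity
import Literature.Probability.LatticeModels.CriticalTwoPointBounds
import Literature.Probability.Percolation.ConstrainedClusters
import HarnessLib

/-!
# Objects of the line `screening-form-lemma-a1` for the crux `GapForcesFarMerging`
(item stmt-CriticalPhenomena-4468; route decl
`Summit.CriticalPhenomena.Ising3DConformalLimit.Theses.EnergyNotSigmaSquared.GapForcesFarMerging`)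

Route-posited objects (D-0016: the definitions a line posits live in a reviewed `…Defs` file, never
inside a proof file; precedent `EnergyNotSigmaSquaredRungOneAdjacentMergingDefs.lean`). The line
(checked skeleton `Cruxes/GapForcesFarMerging/Lines/screening-form-lemma-a1.lean`, planner
`planner-cruxplan-stmt-CriticalPhenomena-4468-screening-form-lemma-0`, lead
`prover-line-stmt-CriticalPhenomena-4468-1`) integrates the second strand of the two-current avoidance
probability controlled by the energy gap OUT, by the freeze-the-cluster identity of
Aizenman–Duminil-Copin 2021, Lemma A.1 (tree theorem `Current.tsum_epairWeight_eq_tsum_mul_offRatio`):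
`P^{ox}⊗P^{ab}_{Λ_n}[o ↮ a] = E^{ox,∅}_{Λ_n}[𝟙[a,b ∉ C]·S_{ab}(C)]`, `C = C_{n₁+n₂}(o)` the duplicated
cluster and `S_{ab}(T) = ⟨σ_aσ_b⟩_{Λ_n∖T}/⟨σ_aσ_b⟩_{Λ_n}` the (Griffiths-antitone) SCREENING RATIO of a
deterministic obstacle `T`.

Contents (definitional bookkeeping only; every piece of mathematics is in the stub files
`Theorems/EnergyNotSigmaSquaredGapForcesFarMerging*.lean` that import this module):
* finite volume (`Λ_n = box 3 n`, `β = β_c(3)`, free boundary condition): `boxTwoPoint`, `screening`,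
  `innerCluster`, `screenWeight`, `meanScreening`, the one-pinch ladder `pinchScreen`;
* the currencies of the line (statements of the registered stubs): `OnePinchGap` (= the landed shape
  `SinglePinchLawShape cc2 (criticalTwoPoint 3) (criticalCorr 3 4)` of line `rp-unpinch-single-passage`),
  `ScreeningIdentity` (the Lemma-A.1 dictionary), `OnePinchScreeningDecay`, `DoublingWindow`, `Floors`,
  `RootOpacityIO`, `FarScreeningIO`, and the finite-graph hitting engine `HittingLowerBound`.
The lattice vocabulary `e₁, e₂, cc2, xR, up, dn, FarMergingShape, SinglePinchLawShape` is that of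
`Theorems/GapForcesFarMerging/Negative/{SoftShapes,LineShapes}.lean` (imported, not restated; users
`open Summit.CriticalPhenomena.Ising3DConformalLimit.Theorems.GapForcesFarMerging.Negative (…)`).

References: Aizenman–Duminil-Copin 2021 (arXiv:1912.07973) §3 (3.7), (3.11), Appendix A Lemma A.1,
Prop. A.3, §6.2; Aizenman–Duminil-Copin–Sidoravicius 2015 Lemma 2.2 (restricted switching);
Aizenman 1982 Prop. 5.3; Lawler 1991 ch. 3–5 (separation lemmas, the template of `Floors`).
-/

noncomputable section

namespace Summit.CriticalPhenomena.Ising3DConformalLimit.GapForcesFarMergingScreening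

open scoped symmDiff ENNReal
open MeasureTheory Filter Finset
open Literature.Probability.LatticeModels Literature.Probability.Percolation
open Summit.CriticalPhenomena.Ising3DConformalLimit.Theorems.GapForcesFarMerging.Negative
  (e₁ e₂ cc2 xR up dn FarMergingShape SinglePinchLawShape)

/-! ### Screening vocabulary (finite volume `Λ_n = box 3 n`, `β = β_c(3)`, free boundary condition) -/

/-- The depleted box two-point function `⟨σ_aσ_b⟩_{Λ_n ∖ T}` at `β_c(3)`: free boundary condition on the
region `Λ_n ∖ T`, which deletes exactly the nearest-neighbour bonds meeting `T` (the restricted state of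
ADC21 Lemma A.1; `T = ∅` gives `⟨σ_aσ_b⟩⁰_{Λ_n}`). [cite: AizenmanDuminilCopinAnnals2021, Appendix A, Lemma A.1] -/
def boxTwoPoint (n : ℕ) (T : Finset (Site 3)) (a b : Site 3) : ℝ :=
  isingTwoPoint (zdGraph 3) (box 3 n \ T) (criticalBeta 3) 0 .free a b

/-- SCREENING RATIO of the obstacle `T` for the probe pair `(a,b)` in `Λ_n`:
`S⁽ⁿ⁾_{ab}(T) = ⟨σ_aσ_b⟩_{Λ_n∖T}/⟨σ_aσ_b⟩_{Λ_n} ∈ [0,1]`, antitone in `T` (Griffiths II); by restricted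
switching it is the probability that the fresh probe strand `a → b` dressed by a vacuum in `Λ_n ∖ T` avoids
`T`. [cite: AizenmanDuminilCopinSidoraviciusCMP2015, Lemma 2.2] -/
def screening (n : ℕ) (T : Finset (Site 3)) (a b : Site 3) : ℝ :=
  boxTwoPoint n T a b / boxTwoPoint n ∅ a b

open Classical in
/-- The cluster of `o` EXPLORED INSIDE `Λ_r`: vertices of `Λ_r` joined to `o` by open bonds of `ω` with both
endpoints in `Λ_r` (non-decreasing in `r`; the whole cluster once `Λ_r` carries the trace). [cite: AizenmanDuminilCopinAnnals2021, §6.2] -/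
def innerCluster (r : ℕ) (o : Site 3) (ω : BondConfig (Site 3)) : Finset (Site 3) :=
  (box 3 r).filter fun v => v ∈ openClusterIn (withinGraph (zdGraph 3) (↑(box 3 r) : Set (Site 3))) ω o

open Classical in
/-- The screening functional of the explored duplicated cluster, `𝟙[a,b ∉ C(o)] · S⁽ⁿ⁾_{ab}(C_r(o))` (zero as
soon as a probe point is swallowed by the FULL cluster); pointwise antitone in `r`. [cite: AizenmanDuminilCopinAnnals2021, Appendix A, Lemma A.1] -/
def screenWeight (n r : ℕ) (o a b : Site 3) (ω : BondConfig (Site 3)) : ℝ :=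
  if a ∈ openCluster ω o ∨ b ∈ openCluster ω o then 0 else screening n (innerCluster r o ω) a b

/-- MEAN SCREENING `𝔼^{ox,∅}_{Λ_n,β_c}[𝟙[a,b ∉ C(o)]·S⁽ⁿ⁾_{ab}(C_r(o))]` under the box law of the trace of the
sourced pair `∂n₁ = {o} ∆ {x}`, `∂n₂ = ∅` (a finitely supported push-forward, so the integral is a finite
sum). For `r = n` (full cluster) Lemma A.1 makes it EQUAL to the two-current avoidance probability
`P^{ox}_{Λ_n}⊗P^{ab}_{Λ_n}[o ↮ a]` (`ScreeningIdentity`). [cite: AizenmanDuminilCopinAnnals2021, Appendix A, Lemma A.1] -/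
def meanScreening (n r : ℕ) (o x a b : Site 3) : ℝ :=
  ∫ ω, screenWeight n r o a b ω ∂(sourcedDoubleCurrentLaw 3 n (criticalBeta 3) ({o} ∆ {x}) ∅)

/-- THE ONE-PINCH SCREENING LADDER `A⁽ⁿ⁾(r; m)`: duplicated strand `0 → up m`, explored inside `Λ_r`, probed
by the pair `(e₂, dn m)` — one adjacent pinch `(0,e₂)` at the root, far ends `up m = (2m,m,0)`,
`dn m = (2m,-m,0)` un-pinched. `r ↦ A(r;m)` is antitone; `A(n;m)` is the full one-pinch avoidance probability. [folklore] -/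
def pinchScreen (n r m : ℕ) : ℝ := meanScreening n r 0 (up m) e₂ (dn m)

/-! ### Currencies of the line (the statements composed by the registered skeleton) -/

/-- (C1) ONE-PINCH GAP, correlation form, exponent `κ' > 0` written in, all scales:
`⟨σ₀σ_{e₂} ; σ_{up m}σ_{dn m}⟩ ≤ C(2m)^{-κ'}⟨σ₀σ_{2me₁}⟩²`, `m ≥ 1` — literally the landed shape
`SinglePinchLawShape cc2 (criticalTwoPoint 3) (criticalCorr 3 4)` of line `rp-unpinch-single-passage`, which
GAP gives with `κ' = κ/2` (RP halving, tree theorem `singlePinchLawShape_of_gap`). Statement consumed by the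
registered stub `stub_screeningDecay` (route-posited currency of the line, not a literature fact). -/
def OnePinchGap : Prop := SinglePinchLawShape cc2 (criticalTwoPoint 3) (criticalCorr 3 4)

/-- (C0) THE SCREENING DICTIONARY (ADC21 Lemma A.1 at the full radius, read on the box trace laws): for
`o, x, a, b ∈ Λ_n`, the mean screening of the probe pair `(a,b)` by the full duplicated cluster of the strand
`o → x` IS the two-current avoidance probability,
`meanScreening n n o x a b = 1 - P^{{o}∆{x},{a}∆{b}}_{Λ_n,β_c}[o ↔ a]`
(`F = 𝟙[a,b ∉ C]` is local in the second current and vanishes when `C ∩ ({a}∆{b}) ≠ ∅`; under `P^{ox,ab}`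
the event `{a ∉ C_{n₁+n₂}(o)}` is `{o ↮ a}` read on the trace, `sourcedTrace_preimage_openConn`). Statement of the
registered stub `stub_screeningIdentity` (route-posited currency of the line). -/
def ScreeningIdentity : Prop :=
  ∀ n : ℕ, ∀ o x a b : Site 3, o ∈ box 3 n → x ∈ box 3 n → a ∈ box 3 n → b ∈ box 3 n →
    meanScreening n n o x a b =
      1 - (sourcedDoubleCurrentLaw 3 n (criticalBeta 3) ({o} ∆ {x}) ({a} ∆ {b})).real (openConn o a)

/-- (C2) ONE-PINCH SCREENING DECAY: for infinitely many far scales `m` (the doubling scales of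
`G(·e₁)`), eventually in the box size, the full one-pinch mean screening is `≤ C m^{-κ}`, `κ > 0`: the
duplicated strand of `(0, up m)` screens its adjacent probe `e₂` from `dn m` polynomially. Conclusion of the
registered stub `stub_screeningDecay` (route-posited currency of the line). -/
def OnePinchScreeningDecay : Prop :=
  ∃ κ C : ℝ, 0 < κ ∧ ∃ᶠ m : ℕ in atTop, ∀ᶠ n : ℕ in atTop, pinchScreen n n m ≤ C * (m : ℝ) ^ (-κ)

/-- DOUBLING WINDOW at octave `k` with constant `θ`: `G(2^{j+1}e₁) ≥ θ·G(2^je₁)` for `|j - k| ≤ 3`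
(`G = criticalTwoPoint 3`); with MMS folding this is ADC21's regularity (P1) on `Λ_{2^{k+3}}∖Λ_{2^{k-3}}`.
Since `∏_{j<J}G(2^{j+1}e₁)/G(2^je₁) ≥ c·4^{-J}` (`criticalTwoPoint_bounds_holds`), octaves WITHOUT a
`θ`-window have upper density `≤ 7 log 4 / log(1/θ)`. [cite: AizenmanDuminilCopinAnnals2021, Def. 5.11 (P1)] -/
def DoublingWindow (θ : ℝ) (k : ℕ) : Prop :=
  ∀ j : ℕ, k ≤ j + 3 → j ≤ k + 3 →
    θ * criticalTwoPoint 3 (((2 : ℤ) ^ j) • e₁) ≤ criticalTwoPoint 3 (((2 : ℤ) ^ (j + 1)) • e₁)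

/-- (C3) FLOORS of the ladder (quasi-multiplicativity FROM BELOW; the printed missing input `m_k ≤ 1-δ` of
the gen-1 Disproof `density_of_prod_le_two_pow`, here a typed currency): (octave floor) one more octave of
explored duplicated cluster costs at most a factor `δ` of tilted mean screening, uniformly in the octave
`j ≥ j₀`, the far scale `m ≥ 2^{j+4}` and large `n`; (bulk floor) from radius `2^k ≍ m/8` to the full
cluster costs at most a factor `δ` (the far pinch is open: `‖up m - dn m‖ = 2m`). Conclusion of the registered
(open) stub `stub_floors`; template: the separation lemmas of Lawler 1991, ch. 3–5 (route-posited currency). -/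
def Floors : Prop :=
  ∃ δ : ℝ, 0 < δ ∧
    (∀ᶠ j : ℕ in atTop, ∀ m : ℕ, 2 ^ (j + 4) ≤ m →
      ∀ᶠ n : ℕ in atTop, δ * pinchScreen n (2 ^ j) m ≤ pinchScreen n (2 ^ (j + 1)) m) ∧
    (∀ᶠ k : ℕ in atTop, ∀ m : ℕ, 2 ^ (k + 3) ≤ m → m < 2 ^ (k + 4) →
      ∀ᶠ n : ℕ in atTop, δ * pinchScreen n (2 ^ k) m ≤ pinchScreen n n m)

/-- (C4) OPAQUE ROOT OCTAVES, WINDOWED, INFINITELY OFTEN: there are `c, θ > 0` such that for infinitely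
many octaves `k` — each inside a `θ`-doubling window — some far scale `m ≥ 2^{k+3}` has, for infinitely many
box sizes, a relative screening drop `≥ c` across the octave `Λ_{2^{k+1}}∖Λ_{2^k}` of the explored cluster:
`0 < A(2^k;m)` and `A(2^{k+1};m) ≤ (1-c)·A(2^k;m)`. Conclusion of the registered stub `stub_rootOpacity`
(route-posited currency of the line). -/
def RootOpacityIO : Prop :=
  ∃ c θ : ℝ, 0 < c ∧ 0 < θ ∧ ∃ᶠ k : ℕ in atTop, DoublingWindow θ k ∧ ∃ m : ℕ, 2 ^ (k + 3) ≤ m ∧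
    ∃ᶠ n : ℕ in atTop, 0 < pinchScreen n (2 ^ k) m ∧
      pinchScreen n (2 ^ (k + 1)) m ≤ (1 - c) * pinchScreen n (2 ^ k) m

/-- (C5) FAR SCREENING ALONG DILATIONS OF ONE SHAPE: some injective lattice quadruple `y` and `c > 0` such
that for infinitely many `L`, for infinitely many box sizes, the full duplicated cluster of `(Ly₀, Ly₁)`
screens the far pair `(Ly₂, Ly₃)` by a definite fraction: mean screening `≤ 1 - c`. Conclusion of the registered
(open, hardest) stub `stub_farScreening`; the screening form of Aizenman's far merging (route-posited currency). -/
def FarScreeningIO : Prop :=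
  ∃ c : ℝ, 0 < c ∧ ∃ y : Fin 4 → Site 3, Function.Injective y ∧ ∀ L₀ : ℕ, ∃ L : ℕ, L₀ ≤ L ∧
    ∃ᶠ n : ℕ in atTop,
      meanScreening n n ((L : ℤ) • y 0) ((L : ℤ) • y 1) ((L : ℤ) • y 2) ((L : ℤ) • y 3) ≤ 1 - c

/-- (H) THE HITTING ENGINE — a Paley–Zygmund capacity lower bound for the duplicated cluster against a
DETERMINISTIC obstacle, finite graphs, couplings `K ≥ 0` (so every depleted domain `Λ ∖ T` is the case
`K = koff`): with `Z[A] = ecurrentSum K A`, `C(x) = C_{n₁+n₂}(x)` under the pair weights `1{∂n₁={x,y}}1{∂n₂=∅}ww`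
and `B(s,t) = Z[xs]Z[st]Z[ty] + Z[xt]Z[ts]Z[sy]`,
`(Σ_{s∈T} Z[xs]Z[sy])² · Z[∅] ≤ (Σ_{s,t∈T} B(s,t)) · Σ 1{∂n₁={x,y}}1{∂n₂=∅} w w 𝟙[C(x) ∩ T ≠ ∅]`,
i.e. `P^{xy,∅}[C(x) ∩ T ≠ ∅] ≥ (Σ_{s∈T}G(x,s)G(s,y))² / (G(x,y)·Σ_{s,t∈T}B(s,t))` — first moment by the exact
one-point density (`tsum_epairWeight_mul_indicator_mem_cluster`), second moment by Prop. A.3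
(`Current.ecurrentSum_empty_mul_tsum_double_conn_le`), Cauchy–Schwarz
(`Current.tsum_mul_sq_le_tsum_indicator_mul_tsum_sq`). Statement of the registered stub `stub_hittingBound`
(a finite-graph inequality posited by the line; proof route ADC21 Appendix A Prop. A.3 and §4.2 Lemma 4.4). -/
def HittingLowerBound : Prop :=
  ∀ (V : Type) [Fintype V] [DecidableEq V] (G : SimpleGraph V) [DecidableRel G.Adj]
    (K : G.edgeFinset → ℝ), (∀ e, 0 ≤ K e) → ∀ (x y : V) (T : Finset V),
    (∑ s ∈ T, ecurrentSum K ({x} ∆ {s}) * ecurrentSum K ({s} ∆ {y})) ^ 2 * ecurrentSum K ∅ ≤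
      (∑ s ∈ T, ∑ t ∈ T,
          (ecurrentSum K ({x} ∆ {s}) * ecurrentSum K ({s} ∆ {t}) * ecurrentSum K ({t} ∆ {y}) +
            ecurrentSum K ({x} ∆ {t}) * ecurrentSum K ({t} ∆ {s}) * ecurrentSum K ({s} ∆ {y}))) *
        ∑' p : Current G × Current G,
          epairWeight K ({x} ∆ {y}) ∅ p * (if Disjoint T ((p.1 + p.2).cluster x) then 0 else 1)

/-! ### Sanity lemmas (definitional) -/

/-- The ladder at the full radius is the full one-pinch mean screening (definitional). [folklore] -/
theorem pinchScreen_full : ∀ n m : ℕ, pinchScreen n n m = meanScreening n n 0 (up m) e₂ (dn m) :=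
  fun _ _ => rfl

/-- `OnePinchGap` is the single-pinch law of line `rp-unpinch-single-passage` at the critical correlators
(definitional), so that the landed `singlePinchLawShape_of_gap : EnergyGapPowerLaw → SinglePinchLawShape …`
discharges it. [folklore] -/
theorem onePinchGap_iff : OnePinchGap ↔ SinglePinchLawShape cc2 (criticalTwoPoint 3) (criticalCorr 3 4) :=
  Iff.rfl

end Summit.CriticalPhenomena.Ising3DConformalLimit.GapForcesFarMergingScreening

end
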